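import Summits.CriticalPhenomena.SAWScalingLimit.Theses.SAWRestrictionRigidity
import Summits.CriticalPhenomena.SAWScalingLimit.Theorems.SAWDevelopingMapHexTransferLinearPinning
import Summits.CriticalPhenomena.SAWScalingLimit.Theorems.SAWDefectDecoherenceHexTransferStretchRigidity
import Literature.Probability.RandomPlanarGeometry.ConformalRestrictionHolds
import Literature.Probability.RandomPlanarGeometry.SLEUniquenessInLaw
import Literature.Probability.RandomPlanarGeometry.LatticeSimilarityCovariance
import HarnessLib

/-!
# Stub `stub_noLinearSymmetry` of line `registered` (crux stmt-CriticalPhenomena-1368,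
# `Theses.SAWRestrictionRigidity.Rigidity`)

**No hidden linear symmetry of the conformally covariant restriction family on simple curves.**
A chordal, conformally covariant family `S` with two-sided restriction carried by simple
boundary-avoiding curves is chordal SLE(8/3) in every Dobrushin domain (Lawler–Schramm–Werner 2003,
p. 5 result 2, PROVED in the tree as `LawlerSchrammWerner2003_holds`). If `S` is moreover covariant
under a real-linear automorphism `M` of the plane, `S (M D) = M_* (S D)`, then `M` is complex-linear
(`M z = c z`) or complex-antilinear (`M z = c z̄`) — Beffara's "an extra symmetry pins the modulus".

Proof. By uniqueness in law of chordal SLE(8/3) (`IsSLELaw.unique'`), `M` belongs to the class `Pcov`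
of plane homeomorphisms pushing every SLE(8/3) law of every Dobrushin domain to an SLE(8/3) law of
the image domain; `Pcov` contains the rotation-dilations and is closed under composition
(`isSLELaw_map_similarity_eightThirds`, `isSLELaw_map_trans_eightThirds`) and is stretch-rigid
(`stub_stretchRigidity`, the hard analytic input: SLE(8/3) admits no axis-stretch covariance).
Write `M z = A z + B z̄`.
* `|B| < |A|` (orientation-preserving): the abstract rigidity lemma `eq_zero_of_stretchRigid_class`
  gives `B = 0`.
* `|A| < |B|` (orientation-reversing): for `u ∈ {1, i}` the composite `N_u = M ∘ (u ·) ∘ M ∈ Pcov` is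
  orientation-preserving with complex form `(A² u + |B|² ū) z + B (A u + Ā ū) z̄`, so the same lemma
  gives `B (A + Ā) = 0` and `B i (A − Ā) = 0`, whence `A = 0`.
* `|A| = |B|`: `M ((A − B) Ā) = A (|A|² − |B|²) = 0`, so by injectivity `A = 0` (then `B = 0` and
  `M 1 = 0`) or `A = B` (then `M i = 0`), absurd.
-/

noncomputable section

namespace Summit.CriticalPhenomena.SAWScalingLimit.Cruxes.Rigidity.Birth

open MeasureTheory
open scoped NNReal ComplexConjugate
open Literature.Probability.RandomPlanarGeometry
open Summit.CriticalPhenomena.SAWScalingLimit.Cruxes.HexTransfer.PinTheShear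

/-! ### Algebra of real-linear maps in complex form -/

/-- A continuous real-linear self-map of `ℂ` is determined by its values at `1` and `i`:
`M z = (Re z) M 1 + (Im z) M i`. [folklore] -/
theorem clm_apply_eq_re_mul_add_im_mul (M : ℂ ≃L[ℝ] ℂ) (z : ℂ) :
    M z = (z.re : ℂ) * M 1 + (z.im : ℂ) * M Complex.I := by
  have h1 : M (z.re : ℂ) = (z.re : ℂ) * M 1 :=
    calc M (z.re : ℂ) = M ((z.re : ℝ) • (1 : ℂ)) := by rw [Complex.real_smul, mul_one]
      _ = (z.re : ℝ) • M 1 := M.map_smul _ _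
      _ = (z.re : ℂ) * M 1 := Complex.real_smul
  have h2 : M ((z.im : ℂ) * Complex.I) = (z.im : ℂ) * M Complex.I := by
    rw [← Complex.real_smul, M.map_smul, Complex.real_smul]
  conv_lhs => rw [← Complex.re_add_im z]
  rw [map_add, h1, h2]

/-- Complex form of the real-linear map `z ↦ (Re z) a + (Im z) b`: it is `z ↦ A z + B z̄` with
`A = (a − i b) / 2`, `B = (a + i b) / 2`, written out in coordinates. [folklore] -/
theorem re_mul_add_im_mul_eq (a b z : ℂ) :
    (z.re : ℂ) * a + (z.im : ℂ) * b =
      (⟨(a.re + b.im) / 2, (a.im - b.re) / 2⟩ : ℂ) * z +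
        (⟨(a.re - b.im) / 2, (a.im + b.re) / 2⟩ : ℂ) * conj z := by
  apply Complex.ext <;> simp <;> ring

/-- Complex form of the composite `z ↦ M (u M z)` when `M z = A z + B z̄`: it is
`z ↦ (A² u + B B̄ ū) z + (A B u + B Ā ū) z̄`. [folklore] -/
theorem comp_mul_comp_form (A B u z : ℂ) :
    A * (u * (A * z + B * conj z)) + B * conj (u * (A * z + B * conj z)) =
      (A * A * u + B * conj B * conj u) * z + (A * B * u + B * conj A * conj u) * conj z := by
  simp only [map_mul, map_add, Complex.conj_conj]
  ring

/-- The determinant of the composite `z ↦ M (u M z)` in complex form: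
`|A_u|² − |B_u|² = |u|² (|A|² − |B|²)²`. [folklore] -/
theorem comp_mul_comp_det (A B u : ℂ) :
    Complex.normSq (A * A * u + B * conj B * conj u) -
        Complex.normSq (A * B * u + B * conj A * conj u) =
      Complex.normSq u * (Complex.normSq A - Complex.normSq B) ^ 2 := by
  apply Complex.ofReal_injective
  push_cast
  simp only [← Complex.mul_conj, map_mul, map_add, Complex.conj_conj]
  ring

/-- The composite `z ↦ M (u M z)` (`u ≠ 0`, `|A| ≠ |B|`) has positive determinant:
`|A B u + B Ā ū| < |A² u + B B̄ ū|`. [folklore] -/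
theorem norm_comp_mul_comp_lt {A B u : ℂ} (hu : u ≠ 0) (hAB : ‖A‖ ≠ ‖B‖) :
    ‖A * B * u + B * conj A * conj u‖ < ‖A * A * u + B * conj B * conj u‖ := by
  have hR := comp_mul_comp_det A B u
  have hne : Complex.normSq A - Complex.normSq B ≠ 0 := by
    intro h0
    apply hAB
    rw [Complex.normSq_eq_norm_sq, Complex.normSq_eq_norm_sq, sub_eq_zero] at h0
    exact (pow_left_inj₀ (norm_nonneg A) (norm_nonneg B) two_ne_zero).1 h0
  have hpos : 0 < Complex.normSq u * (Complex.normSq A - Complex.normSq B) ^ 2 :=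
    mul_pos (Complex.normSq_pos.2 hu) (even_two.pow_pos hne)
  have h2 : ‖A * B * u + B * conj A * conj u‖ ^ 2 < ‖A * A * u + B * conj B * conj u‖ ^ 2 := by
    rw [← Complex.normSq_eq_norm_sq, ← Complex.normSq_eq_norm_sq]
    linarith
  exact lt_of_pow_lt_pow_left₀ 2 (norm_nonneg _) h2

/-! ### The stub -/

/-- Stub `stub_noLinearSymmetry` of line `registered` (crux stmt-CriticalPhenomena-1368). **No
hidden linear symmetry of chordal SLE(8/3)**: a chordal, conformally covariant, restriction family
`S` carried by simple boundary-avoiding curves (chordal SLE(8/3) in every domain, by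
`LawlerSchrammWerner2003_holds`) which is covariant under a real-linear automorphism `M` of the plane
has `M` complex-linear or complex-antilinear. By uniqueness in law (`IsSLELaw.unique'`) `M` is a
covariance of the SLE(8/3) law family; writing `M z = A z + B z̄`, stretch rigidity of SLE(8/3)
(`stub_stretchRigidity`) through the abstract rigidity lemma `eq_zero_of_stretchRigid_class` gives
`B = 0` if `|B| < |A|`, and applied to the orientation-preserving composites `M ∘ (u ·) ∘ M`
(`u = 1, i`) gives `A = 0` if `|A| < |B|`; `|A| = |B|` contradicts injectivity of `M`. [folklore] -/
theorem stub_noLinearSymmetry : ∀ (S : Literature.Probability.RandomPlanarGeometry.ChordalFamily) (M : ℂ ≃L[ℝ] ℂ), S.IsChordal → S.IsConformallyCovariant → S.IsRestriction → (∀ D : Literature.Probability.RandomPlanarGeometry.DobrushinDomain, ∀ᵐ γ ∂(S D), γ ∈ Literature.Probability.RandomPlanarGeometry.CurveClass.simple ∧ γ.range ∩ frontier D.carrier ⊆ {D.pt 0, D.pt 1}) → (∀ D : Literature.Probability.RandomPlanarGeometry.DobrushinDomain, S (D.map M.toHomeomorph) = (S D).map (Literature.Probability.RandomPlanarGeometry.CurveClass.map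 (M.toHomeomorph : C(ℂ, ℂ)))) → (∃ c : ℂ, ∀ z : ℂ, M z = c * z) ∨ (∃ c : ℂ, ∀ z : ℂ, M z = c * (starRingEnd ℂ) z) := by
  intro S M hch hcc hres hsimple hM
  -- LSW 2003: `S` is chordal SLE(8/3) in every Dobrushin domain
  have hSLE : ∀ D : DobrushinDomain, IsSLELaw ((8 : ℝ≥0) / 3) D (S D) :=
    LawlerSchrammWerner2003_holds S hch hcc hres hsimple
  -- the class of covariances of the SLE(8/3) law family, and `M ∈ Pcov`
  let Pcov : (ℂ ≃ₜ ℂ) → Prop := fun Ψ =>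
    ∀ (D : DobrushinDomain) (μ : Measure (CurveClass ℂ)), IsSLELaw ((8 : ℝ≥0) / 3) D μ →
      IsSLELaw ((8 : ℝ≥0) / 3) (D.map Ψ) (μ.map (CurveClass.map (Ψ : C(ℂ, ℂ))))
  have hK : ∀ (c : ℂ) (hc : c ≠ 0), Pcov (similarity c hc 0) := isSLELaw_map_similarity_eightThirds
  have hmul : ∀ Ψ₁ Ψ₂ : ℂ ≃ₜ ℂ, Pcov Ψ₁ → Pcov Ψ₂ → Pcov (Ψ₁.trans Ψ₂) :=
    isSLELaw_map_trans_eightThirds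
  have hSR : ∀ s : ℝ, 0 < s →
      (∀ Φ : ℂ ≃ₜ ℂ, (∀ z : ℂ, Φ z = (z.re : ℂ) + ((s * z.im : ℝ) : ℂ) * Complex.I) → Pcov Φ) →
        s = 1 := stub_stretchRigidity
  have hPM : Pcov M.toHomeomorph := by
    intro D μ hμ
    rw [hμ.unique' (hSLE D), ← hM D]
    exact hSLE _
  -- complex form `M z = A z + B conj z`
  set A : ℂ := ⟨((M 1).re + (M Complex.I).im) / 2, ((M 1).im - (M Complex.I).re) / 2⟩ with hA_def
  set B : ℂ := ⟨((M 1).re - (M Complex.I).im) / 2, ((M 1).im + (M Complex.I).re) / 2⟩ with hB_def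
  have hAB : ∀ z : ℂ, M z = A * z + B * conj z := fun z => by
    rw [clm_apply_eq_re_mul_add_im_mul M z, re_mul_add_im_mul_eq]
  have hΦ : ∀ z : ℂ, M.toHomeomorph z = A * z + B * conj z := hAB
  rcases lt_trichotomy ‖B‖ ‖A‖ with hlt | heq | hgt
  · -- orientation-preserving: `B = 0`
    have hB0 : B = 0 := eq_zero_of_stretchRigid_class (P := Pcov) hK hmul hSR hlt hΦ hPM
    refine Or.inl ⟨A, fun z => ?_⟩
    rw [hAB z, hB0, zero_mul, add_zero]
  · -- degenerate: contradicts injectivity of `M`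
    exfalso
    have hnsq : Complex.normSq A = Complex.normSq B := by
      rw [Complex.normSq_eq_norm_sq, Complex.normSq_eq_norm_sq, heq]
    have h0 : M ((A - B) * conj A) = 0 := by
      rw [hAB, map_mul, map_sub, Complex.conj_conj]
      linear_combination (A : ℂ) * Complex.mul_conj A - A * Complex.mul_conj B +
        A * congrArg (fun r : ℝ => (r : ℂ)) hnsq
    have hz : (A - B) * conj A = 0 := M.injective (h0.trans (map_zero M).symm)
    rcases mul_eq_zero.1 hz with hAB0 | hA0
    · have hI : M Complex.I = 0 := by
        rw [hAB, Complex.conj_I, sub_eq_zero.1 hAB0]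
        ring
      exact Complex.I_ne_zero (M.injective (hI.trans (map_zero M).symm))
    · have hA0' : A = 0 := by simpa using hA0
      have hB0 : B = 0 := Complex.normSq_eq_zero.1 (by rw [← hnsq, hA0', map_zero])
      have h1 : M 1 = 0 := by rw [hAB, hA0', hB0, zero_mul, zero_mul, add_zero]
      exact one_ne_zero (M.injective (h1.trans (map_zero M).symm))
  · -- orientation-reversing: `A = 0`
    have hB : B ≠ 0 := norm_pos_iff.1 ((norm_nonneg A).trans_lt hgt)
    have hne : ‖A‖ ≠ ‖B‖ := hgt.ne
    -- the orientation-preserving composites `N_u = M ∘ (u ·) ∘ M`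
    have hN : ∀ (u : ℂ) (hu : u ≠ 0), A * B * u + B * conj A * conj u = 0 := by
      intro u hu
      refine eq_zero_of_stretchRigid_class (P := Pcov) hK hmul hSR (norm_comp_mul_comp_lt hu hne)
        (Φ := M.toHomeomorph.trans ((similarity u hu 0).trans M.toHomeomorph)) (fun z => ?_) ?_
      · rw [Homeomorph.trans_apply, Homeomorph.trans_apply, similarity_apply, add_zero]
        change M (u * M z) = _
        rw [hAB (u * M z), hAB z, comp_mul_comp_form]
      · exact hmul _ _ hPM (hmul _ _ (hK u hu) hPM)
    have h1 := hN 1 one_ne_zero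
    have hI := hN Complex.I Complex.I_ne_zero
    rw [map_one] at h1
    rw [Complex.conj_I] at hI
    have hsum : A + conj A = 0 := by
      have : B * (A + conj A) = 0 := by linear_combination h1
      exact (mul_eq_zero.1 this).resolve_left hB
    have hdiff : A - conj A = 0 := by
      have : (B * Complex.I) * (A - conj A) = 0 := by linear_combination hI
      exact (mul_eq_zero.1 this).resolve_left (mul_ne_zero hB Complex.I_ne_zero)
    have hA0 : A = 0 := by linear_combination (hsum + hdiff) / 2
    refine Or.inr ⟨B, fun z => ?_⟩
    rw [hAB z, hA0, zero_mul, zero_add]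

end Summit.CriticalPhenomena.SAWScalingLimit.Cruxes.Rigidity.Birth

end
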